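import Literature.Analysis.SpecialFunctions.KernelLog
import Literature.NumberTheory.LFunctions.Envelope
import Literature.Analysis.SpecialFunctions.EulerMascheroniBounds
import HarnessLib

/-!
# The colossally abundant chain checker: computable core and arithmetic soundness
# (plan N1 of provefact `Literature.NumberTheory.LFunctions.robin_iff`)

Topic: `Literature/NumberTheory/LFunctions`. The finite statement `robinCA_below (4^11)` of
`RobinAnalyticSharp.lean` — Robin's inequality `σ(N) < e^γ N log log N` for every colossally
abundant `N > 5040` all of whose primes are `< 4¹¹` — is certified by walking the **chain of
colossally abundant numbers** (Alaoglu–Erdős 1944, §3; Robin 1984, §3): for a decreasing sequence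
of parameters `ε`, the maximiser `N_ε = ∏_q q^{a_q(ε)}` of `σ(m)/m^{1+ε}` gains one prime factor at a
time, and Robin's inequality on `[N, N']` for consecutive members follows from the envelope
`σ(n)/n ≤ (σ(N')/N'^{1+ε}) n^ε` and the concavity of `u ↦ log log u − ε u` by two endpoint checks
(Robin 1984, §3 Prop. 1; `RobinCriterion.lean`). This file is the *computable core* of that
certificate, designed for evaluation **by the kernel** (`decide +kernel`) over the `≈ 3.2·10⁵`
steps up to the prime `4509073`, together with the soundness of its arithmetic primitives; the
semantic soundness (envelope, invariant, Robin's inequality along the run) is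
`ChainCheckSound.lean`, the data `ChainTable.lean`, the run `ChainRun*.lean`, the assembly
`RobinCABelow.lean`.

## The state and one step

Exponents are organised in **levels**: level `j ≥ 1` is the set of table entries `q ≤ x_j`
(threshold `x₁ ≥ x₂ ≥ ⋯ ≥ x_K`), so that `a_q = #{j : q ≤ x_j}`; a virtual level `K+1` with
threshold `1` is kept at the end. Each level caches its *candidate* `c` (the table successor of its
threshold, the next entry to receive exponent `j`) with enclosures of `B = log c` and of
`A = log σ_j(c) − log σ_{j−1}(c) − log c = log(1 + 1/(c σ_{j−1}(c)))`, the scaled critical value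
`ecrit = ⌊2⁸⁰ Alo/Bhi⌋ ≤ 2⁸⁰ A/B` and `need = ⌈2⁸⁰ Ahi/Blo⌉`. A **step** (`step`) picks the level with
the largest `ecrit`, sets the new `ε := ecrit/2⁸⁰` (checked `0 < ε ≤ ε_prev`), moves that level's
threshold to its candidate `c` (the nesting `c ≤ x_{j−1}` is checked), and requires `need ≤ e` for
the candidates of **all** levels of the new state (the ratio tests `A ≤ ε B` that make the new `N'`
the maximiser of `σ(m)/m^{1+ε}`, given a *complete* table of primes); it updates
`Llo ≤ 2⁸⁰ log N`, `Shi ≥ 2⁸⁰ log(σ(N)/N)` and checks Robin's inequality in envelope form at both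
ends, `Shi' < Γ + lll(N')` and `Shi' − ⌊e·Blo_c/2⁸⁰⌋ < Γ + lll(N)` (`robinChk`; `Γ = GAMMALO ≤ 2⁸⁰γ`,
`lll ≤ 2⁸⁰ log log log N` a cached lower bound refreshed lazily by `lllLoN`). Level `1` steps in all
but `≈ 1 %` of the steps and is kept apart (`St.l1`; the maxima `mx`, `nmx` of `ecrit`, `need` over
the other levels are cached), so a typical step costs two short logarithmic series. `T1hi`
accumulates an upper bound for `∑_{q ∈ T, q ≤ x₁} log q ≥ θ(x₁)`, frozen into `ThX` when `x₁` first
passes `X`; the run stops (`done`) once `Llo ≥ ThX + U`, which makes every colossally abundant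
number with primes `< X` smaller than the final `N` (`U/2⁸⁰ = 318000 ≥ √u log u` in the size bound
`log N ≤ θ(P) + √u log u` of `ColossallyAbundantExponents`). Chunks of the run communicate through
compact states `SD` (thresholds and numeric fields; `expand`/`compress`/`runD`), and the initial
state is `N₀ = 55440 = 2⁴·3²·5·7·11` (`initD`, thresholds `11, 3, 2, 2`, `ε₀ = 0.036`, below which
`RobinNumerical.robinInequality_le_55440` applies).

## Arithmetic

All hot-path arithmetic is on `ℕ` with the kernel's primitive operations (`Nat.add`, `Nat.mul`,
`Nat.div`, `Nat.ble`, …, and `bif`), which are GMP-accelerated and avoid type-class unfolding; every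
quantity is a non-negative real scaled by `2⁸⁰`, rounded outward. Logarithms: `lnp p q` encloses
`2⁸⁰ log(1 + p/q)` (`2p ≤ q`) by the alternating series with exact rational terms
`⌊2⁸⁰ p^j/(j q^j)⌋`, stopped when the terms vanish (four or five terms for the increments
`log c' − log c = log(1 + (c'−c)/c)` and `A = log(1 + 1/(c σ_{j−1}(c)))` along the chain), remainder
`≤ y^{m+1}/(1−y)` from Mathlib's `Real.abs_log_sub_add_sum_range_le` (`lnp_sound`); full logarithms
(`logN`, cold path) and `log log` (`lllLo`) come from `KernelLog.logIv`. States and levels are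
destructured by `match` at function entry so that fields passed through unchanged are the
constructor's argument terms themselves (a chain of projection applications `s.ls`, `(s'.ls)`, …
would be re-walked by the kernel's `whnf` at every access and make long runs quadratic). Measured
kernel cost: `≈ 2.5 ms` per step, `≈ 70 µs` per decoded table entry.

**Proved here** (Part 1): `lnpGo_spec`, `lnp_sound`, `logN_sound`, `mulLo_bounds`, the constants
`L2LON ≤ 2⁸⁰ log 2 ≤ L2HIN`, `GAMMALO ≤ 2⁸⁰ γ` (`LogTwoBounds`, `EulerMascheroniBounds`), `gsum` lemmas.
Nothing is asserted: the only `def`s are the computable functions and their constants.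

## References

* L. Alaoglu, P. Erdős, *On highly composite and similar numbers*, Trans. AMS 56 (1944), 448–469,
  §3 (colossally abundant numbers as maximisers of `σ(n)/n^{1+ε}`, critical `ε`). [AlaogluErdos1944]
* G. Robin, *Grandes valeurs de la fonction somme des diviseurs et hypothèse de Riemann*, J. Math.
  Pures Appl. 63 (1984), 187–213, §3 (Prop. 1: interpolation between consecutive colossally
  abundant numbers; the proof of Thm. 1 for small `N` by tables). [Robin1984]
* K. Briggs, *Abundant numbers and the Riemann hypothesis*, Experiment. Math. 15 (2006), 251–256
  (the same chain, computed numerically to `10^(10^10)`). [Briggs2006]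
-/

namespace Literature.NumberTheory.LFunctions.ChainCheck

open Literature.Analysis.SpecialFunctions.KernelLog

/-! ### Constants (scale `2⁸⁰`) -/

/-- The scale `2⁸⁰`. [folklore] -/
def SC : ℕ := 1208925819614629174706176

/-- `⌊0.69314718055994530940 · 2⁸⁰⌋ ≤ 2⁸⁰ log 2` (`LogTwoBounds`). [folklore] -/
def L2LON : ℕ := 837963523372001241299075

/-- `⌈0.69314718055994530944 · 2⁸⁰⌉ ≥ 2⁸⁰ log 2`. [folklore] -/
def L2HIN : ℕ := 837963523372001241347433

/-- `⌊0.57721558 · 2⁸⁰⌋ ≤ 2⁸⁰ γ` (`EulerMascheroniBounds`). [folklore] -/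
def GAMMALO : ℕ := 697810818145833555562946

/-! ### `log(1 + p/q)` by the alternating series, in natural-number fixed point -/

/-- Term loop of the series `∑ (−1)^{j+1} y^j/j`, `y = p/q`: `t_j = ⌊2⁸⁰ p^j/(j q^j)⌋`; odd terms are
added to `pos`, even ones to `neg`, with their counts; stops at the first vanishing term (or when the
fuel is exhausted) and returns `(pos, neg, nodd, neven, t_{m+1})`. Entry invariant: `P = p^j`,
`Q = q^j`. [folklore] -/
def lnpGo (p q : ℕ) : ℕ → ℕ → ℕ → ℕ → ℕ → ℕ → ℕ → ℕ → ℕ × ℕ × ℕ × ℕ × ℕ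
  | 0, j, P, Q, pos, neg, no, ne => (pos, neg, no, ne, Nat.div (Nat.mul SC P) (Nat.mul j Q))
  | fuel + 1, j, P, Q, pos, neg, no, ne =>
    let t := Nat.div (Nat.mul SC P) (Nat.mul j Q)
    bif Nat.beq t 0 then (pos, neg, no, ne, 0)
    else bif Nat.beq (Nat.mod j 2) 1 then
      lnpGo p q fuel (Nat.add j 1) (Nat.mul P p) (Nat.mul Q q) (Nat.add pos t) neg (Nat.add no 1) ne
    else
      lnpGo p q fuel (Nat.add j 1) (Nat.mul P p) (Nat.mul Q q) pos (Nat.add neg t) no (Nat.add ne 1)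

/-- **`lnp p q = (lo, hi)` with `lo ≤ 2⁸⁰ log(1 + p/q) ≤ hi`** for `2p ≤ q`, `0 < q` (`lnp_sound`):
`m` series terms (until they vanish below `2⁻⁸⁰`), remainder `|R| ≤ y^{m+1}/(1−y) ≤ 2 y^{m+1}`.
[folklore] -/
def lnp (p q : ℕ) : ℕ × ℕ :=
  match lnpGo p q 100 1 p q 0 0 0 0 with
  | (pos, neg, no, ne, tn) =>
    let R := Nat.mul (Nat.mul 2 (Nat.add (Nat.add no ne) 1)) (Nat.add tn 1)
    (Nat.sub pos (Nat.add (Nat.add neg ne) R), Nat.sub (Nat.add (Nat.add pos no) R) neg)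

/-- Full logarithm of a natural number `n ≥ 2` as natural fixed point, from `KernelLog.logIv`
(cold path). [folklore] -/
def logN (n : ℕ) : Option (ℕ × ℕ) :=
  match logIv n with
  | some (blo, bhi) => if blo ≤ 0 then none else some (blo.toNat, bhi.toNat)
  | none => none

/-- `σ_j(c) = 1 + c + ⋯ + c^j` as a natural number. [folklore] -/
def gsum (c : ℕ) : ℕ → ℕ
  | 0 => 1
  | j + 1 => Nat.add (Nat.mul c (gsum c j)) 1

/-- `⌊e·b/2⁸⁰⌋`. [folklore] -/
def mulLo (e b : ℕ) : ℕ := Nat.div (Nat.mul e b) SC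

/-! ### Levels -/

/-- A level: index `j ≥ 1` (table entries `≤ x` have exponent `≥ j`), threshold `x`, cursor `rest`
(the table entries `> x`; its head `c` is the candidate), and scaled data of the candidate:
`Blo ≤ 2⁸⁰ log c ≤ Bhi`, `Alo ≤ 2⁸⁰ A ≤ Ahi` with `A = log(1 + 1/(c σ_{j−1}(c)))`
(`= log σ_j(c) − log σ_{j−1}(c) − log c`), `ecrit = ⌊2⁸⁰ Alo/Bhi⌋` (scaled critical `ε`, rounded
down), `need = ⌈2⁸⁰ Ahi/Blo⌉` (the least scaled `ε` at which the candidate's ratio test `A ≤ ε B` is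
certified). [folklore] -/
structure Level where
  /-- level index (`1`-based) -/
  j : ℕ
  /-- threshold -/
  x : ℕ
  /-- table entries above the threshold (head = candidate) -/
  rest : List ℕ
  /-- lower bound of `2⁸⁰ log c` -/
  Blo : ℕ
  /-- upper bound of `2⁸⁰ log c` -/
  Bhi : ℕ
  /-- lower bound of `2⁸⁰ A` -/
  Alo : ℕ
  /-- upper bound of `2⁸⁰ A` -/
  Ahi : ℕ
  /-- scaled critical value, rounded down -/
  ecrit : ℕ
  /-- least admissible scaled `ε` for the ratio test of the candidate -/
  need : ℕ
  deriving Repr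

/-- Build a level from bounds `Blo ≤ 2⁸⁰ log c ≤ Bhi` for its candidate `c = rest.head`. [folklore] -/
def mkLevelB (j x : ℕ) (rest : List ℕ) (Blo Bhi : ℕ) : Option Level :=
  match rest with
  | [] => none
  | c :: _ =>
    let q := Nat.mul c (gsum c (Nat.sub j 1))
    bif Nat.blt q 2 || Nat.beq Blo 0 then none else
    match lnp 1 q with
    | (Alo, Ahi) =>
      some ⟨j, x, rest, Blo, Bhi, Alo, Ahi, Nat.div (Nat.mul Alo SC) Bhi,
        Nat.div (Nat.sub (Nat.add (Nat.mul Ahi SC) Blo) 1) Blo⟩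

/-- Build a level computing `log c` from scratch (cold path). [folklore] -/
def mkLevelFull (j x : ℕ) (rest : List ℕ) : Option Level :=
  match rest with
  | [] => none
  | c :: _ =>
    match logN c with
    | none => none
    | some (blo, bhi) => mkLevelB j x rest blo bhi

/-- Step a level: threshold `:= c` (its candidate), cursor advances, the new candidate's logarithm
is obtained incrementally (`log c' = log c + log(1 + (c'−c)/c)` when `2(c'−c) ≤ c`). [folklore] -/
def mkLevelNext (L : Level) : Option Level :=
  match L with
  | ⟨j, _, rest, Blo, Bhi, _, _, _, _⟩ =>
    match rest with
    | [] => none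
    | [_] => none
    | c :: c' :: t =>
      let d := Nat.sub c' c
      bif Nat.ble (Nat.mul 2 d) c && Nat.ble c c' then
        match lnp d c with
        | (dlo, dhi) => mkLevelB j c (c' :: t) (Nat.add Blo dlo) (Nat.add Bhi dhi)
      else mkLevelFull j c (c' :: t)

/-- Maximum of `ecrit` and of `need` over a list of levels. [folklore] -/
def maxima : List Level → ℕ × ℕ
  | [] => (0, 0)
  | L :: t => match maxima t with
    | (m, n) => (bif Nat.ble L.ecrit m then m else L.ecrit, bif Nat.ble L.need n then n else L.need)

/-- Position of the first level with the largest `ecrit`. [folklore] -/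
def argmax : List Level → ℕ × ℕ
  | [] => (0, 0)
  | L :: t => match argmax t with
    | (i, m) => bif Nat.blt L.ecrit m then (Nat.add i 1, m) else (0, L.ecrit)

/-! ### States -/

/-- The state of the chain: level `1` (hot), the further levels `2, …, K` followed by the virtual
level `K+1` (threshold `1`, cursor = the whole table, candidate `2`); the maxima `mx`, `nmx` of
`ecrit`, `need` over the further levels; scaled bounds `Llo ≤ 2⁸⁰ log N`, `2⁸⁰ log(σ(N)/N) ≤ Shi`,
the current scaled `ε` (`e`), a lower bound `lll ≤ 2⁸⁰ log log log N`, an upper bound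
`T1hi ≥ 2⁸⁰ ∑_{q ∈ T, q ≤ x₁} log q`, and `ThX`, the value of `T1hi` frozen when `x₁` first
reached `X`. [folklore] -/
structure St where
  /-- level 1 -/
  l1 : Level
  /-- levels `2..K` and the virtual level -/
  ls : List Level
  /-- max `ecrit` over `ls` -/
  mx : ℕ
  /-- max `need` over `ls` -/
  nmx : ℕ
  /-- lower bound of `2⁸⁰ log N` -/
  Llo : ℕ
  /-- upper bound of `2⁸⁰ log (σ N / N)` -/
  Shi : ℕ
  /-- current scaled `ε` -/
  e : ℕ
  /-- lower bound of `2⁸⁰ log log log N` -/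
  lll : ℕ
  /-- upper bound of `2⁸⁰ θ_T(x₁)` -/
  T1hi : ℕ
  /-- frozen `T1hi` -/
  ThX : Option ℕ
  deriving Repr

/-- Lower bound (scaled) for `log(n/2^t)`: `logIv n − t log 2` (cold). [folklore] -/
def logScaledLo (t : ℕ) (n : ℕ) : Option ℤ := (logIv n).map fun p => p.1 - t * L2HI

/-- Lower bound for `2⁸⁰ log log L` from `Llo ≤ 2⁸⁰ L` (two short logarithms; cold). [folklore] -/
def lllLo (Llo : ℤ) : Option ℤ :=
  match logScaledLo 10 (Llo / 2 ^ 70).toNat with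
  | none => none
  | some a => if a ≤ 0 then none else logScaledLo 30 (a / 2 ^ 50).toNat

/-- Natural-number interface to `lllLo` (fails unless the bound is positive). [folklore] -/
def lllLoN (Llo : ℕ) : Option ℕ :=
  match lllLo (Llo : ℤ) with
  | none => none
  | some b => if b ≤ 0 then none else some b.toNat

/-- Robin's inequality in envelope form at both ends of a step, with lazy refreshment of the cached
bound `lll`: returns a valid lower bound for `2⁸⁰ log log log N'` or fails. Inputs: `Shi'` (new),
`e` (the step's `ε`), `Bc = Blo` of the stepped candidate, `Llo` (old), `Llo'` (new), `lll` (old).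
Checks: `Shi' − ⌊e Bc/2⁸⁰⌋ < Γ + lll(N)` and `Shi' < Γ + lll(N')`. [folklore] -/
def robinChk (Shi' e Bc Llo Llo' lll : ℕ) : Option ℕ :=
  let lhs2 := Nat.sub Shi' (mulLo e Bc)
  -- check at `N` (with the cached bound, refreshed on failure)
  let lllN : Option ℕ :=
    bif Nat.blt lhs2 (Nat.add GAMMALO lll) then some lll else
      match lllLoN Llo with
      | none => none
      | some v => bif Nat.blt lhs2 (Nat.add GAMMALO v) then some v else none
  match lllN with
  | none => none
  | some v =>
    -- check at `N'` (`v` is also a lower bound there; refreshed on failure)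
    bif Nat.blt Shi' (Nat.add GAMMALO v) then some v else
      match lllLoN Llo' with
      | none => none
      | some w => bif Nat.blt Shi' (Nat.add GAMMALO w) then some w else none

/-- Step the level at position `i` of `ls` (the further levels), given the threshold `xa` of the
level above it; the last level is the virtual one: stepping it makes it real and appends a fresh
virtual level. Returns the new list and the stepped level's old data `(c, Ahi, Blo)`. [folklore] -/
def stepAt (T : List ℕ) : List Level → ℕ → ℕ → Option (List Level × ℕ × ℕ × ℕ)
  | [], _, _ => none
  | L :: t, 0, xa =>
    match L with
    | ⟨j, _, rest, Blo, _, _, Ahi, _, _⟩ =>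
      match rest with
      | [] => none
      | c :: _ =>
        bif Nat.blt xa c then none else
        match t with
        | [] =>
          match mkLevelNext L, mkLevelB (Nat.add j 1) 1 T L2LON L2HIN with
          | some L', some V => some ([L', V], c, Ahi, Blo)
          | _, _ => none
        | _ :: _ =>
          match mkLevelNext L with
          | some L' => some (L' :: t, c, Ahi, Blo)
          | none => none
  | L :: t, i + 1, _ =>
    match stepAt T t i L.x with
    | none => none
    | some (t', d) => some (L :: t', d)

/-- **One step of the chain** with all checks (module docstring). [folklore] -/
def step (T : List ℕ) (X : ℕ) (s : St) : Option St :=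
  match s with
  | ⟨l1, ls, mx, nmx, Llo, Shi, e0, lll, T1hi, ThX⟩ =>
  match l1 with
  | ⟨_, x1, rest, Blo1, Bhi1, _, Ahi1, ecrit1, need1⟩ =>
  bif Nat.ble mx ecrit1 then
    -- hot path: level 1 steps
    bif Nat.beq ecrit1 0 || Nat.blt e0 ecrit1 then none else
    match rest with
    | [] => none
    | c :: _ =>
      match mkLevelNext l1 with
      | none => none
      | some l1' =>
        bif Nat.blt ecrit1 l1'.need || Nat.blt ecrit1 nmx then none else
        let Llo' := Nat.add Llo Blo1
        let Shi' := Nat.add Shi Ahi1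
        let T1hi' := Nat.add T1hi Bhi1
        let ThX' : Option ℕ := match ThX with
          | some v => some v
          | none => bif Nat.ble X c then some T1hi' else none
        bif Nat.beq Llo' 0 || Nat.beq T1hi' 0 then none else
        match robinChk Shi' ecrit1 Blo1 Llo Llo' lll with
        | none => none
        | some lll' => some ⟨l1', ls, mx, nmx, Llo', Shi', ecrit1, lll', T1hi', ThX'⟩
  else
    -- cold path: a further level steps
    match argmax ls with
    | (i, e) =>
      bif Nat.beq e 0 || Nat.blt e0 e then none else
      let xa := match i with
        | 0 => x1
        | i' + 1 => (ls.getD i' ⟨0, 0, [], 0, 0, 0, 0, 0, 0⟩).x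
      match stepAt T ls i xa with
      | none => none
      | some (ls', _, Ahi, Blo) =>
        match maxima ls' with
        | (mx', nmx') =>
          bif Nat.blt e nmx' || Nat.blt e need1 then none else
          let Llo' := Nat.add Llo Blo
          let Shi' := Nat.add Shi Ahi
          bif Nat.beq Llo' 0 then none else
          match robinChk Shi' e Blo Llo Llo' lll with
          | none => none
          | some lll' => some ⟨l1, ls', mx', nmx', Llo', Shi', e, lll', T1hi, ThX⟩

/-- The stopping test: `ThX` frozen and `Llo ≥ ThX + U`. [folklore] -/
def done (U : ℕ) (s : St) : Bool :=
  match s.ThX with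
  | none => false
  | some v => Nat.ble (Nat.add v U) s.Llo

/-- Run at most `fuel` steps (stopping early, successfully, when `done`). [folklore] -/
def run (T : List ℕ) (X U : ℕ) : ℕ → St → Option St
  | 0, s => some s
  | fuel + 1, s =>
    bif done U s then some s else
    match step T X s with
    | none => none
    | some s' => run T X U fuel s'

/-! ### Compact states (chunk boundaries) -/

/-- The data of a state that is carried between chunks of the computation: the thresholds
`x₁ ≥ x₂ ≥ ⋯ ≥ x_K` of the real levels and the scaled numeric fields. [folklore] -/
structure SD where
  /-- thresholds of levels `1..K` -/
  xs : List ℕ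
  /-- lower bound of `2⁸⁰ log N` -/
  Llo : ℕ
  /-- upper bound of `2⁸⁰ log (σ N / N)` -/
  Shi : ℕ
  /-- current scaled `ε` -/
  e : ℕ
  /-- lower bound of `2⁸⁰ log log log N` -/
  lll : ℕ
  /-- upper bound of `2⁸⁰ θ_T(x₁)` -/
  T1hi : ℕ
  /-- frozen `T1hi` -/
  ThX : Option ℕ
  deriving Repr, DecidableEq

/-- The cursor after `x` in the (sorted) table. [folklore] -/
def after (x : ℕ) (T : List ℕ) : List ℕ := T.dropWhile (fun q => Nat.ble q x)

/-- Build the further levels `2, …, K` from their thresholds, then the virtual level `K+1`.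
[folklore] -/
def mkLevels (T : List ℕ) : ℕ → List ℕ → Option (List Level)
  | j, [] => (mkLevelB j 1 T L2LON L2HIN).map fun V => [V]
  | j, x :: xs =>
    match mkLevelFull j x (after x T), mkLevels T (j + 1) xs with
    | some L, some t => some (L :: t)
    | _, _ => none

/-- Expand a compact state. [folklore] -/
def expand (T : List ℕ) (d : SD) : Option St :=
  match d.xs with
  | [] => none
  | x1 :: xs =>
    match mkLevelFull 1 x1 (after x1 T), mkLevels T 2 xs with
    | some l1, some ls =>
      match maxima ls with
      | (mx, nmx) => some ⟨l1, ls, mx, nmx, d.Llo, d.Shi, d.e, d.lll, d.T1hi, d.ThX⟩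
    | _, _ => none

/-- Compress a state (drop the virtual level's threshold). [folklore] -/
def compress (s : St) : SD :=
  ⟨s.l1.x :: (s.ls.map Level.x).dropLast, s.Llo, s.Shi, s.e, s.lll, s.T1hi, s.ThX⟩

/-- **A chunk of the computation** on compact states. [folklore] -/
def runD (T : List ℕ) (X U fuel : ℕ) (d : SD) : Option SD :=
  match expand T d with
  | none => none
  | some s => (run T X U fuel s).map compress

/-! ### The initial state `N₀ = 55440 = 2⁴·3²·5·7·11` -/

/-- Check of the invariant `ratio ≥ 1` at a threshold `x` of level `j` for the scaled `e`:
`2⁸⁰ A(x, j) ≥ e · log x`, i.e. `Alo · 2⁸⁰ ≥ e · Bhi`. [folklore] -/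
def upOK (e j x : ℕ) : Bool :=
  match logN x with
  | none => false
  | some (_, Bhi) =>
    let q := Nat.mul x (gsum x (Nat.sub j 1))
    bif Nat.blt q 2 then false else
    match lnp 1 q with
    | (Alo, _) => Nat.ble (Nat.mul e Bhi) (Nat.mul Alo SC)

/-- The initial compact state at `N₀ = 55440` (thresholds `11, 3, 2, 2`, `ε₀ = 0.036`), with its
numeric fields computed: `Llo` from `log 55440`, `Shi` from `log 232128 − log 55440`
(`σ(55440) = 232128`), `lll`, `T1hi` from `log 2310`; `none` if a check of `ratio ≥ 1` at the
four thresholds fails. [folklore] -/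
def initD : Option SD :=
  let e0 := 43521329506126650289422  -- ⌊0.036 · 2⁸⁰⌋
  bif !(upOK e0 1 11 && upOK e0 2 3 && upOK e0 3 2 && upOK e0 4 2) then none else
  match logN 55440, logN 232128, logN 2310 with
  | some (nlo, _), some (_, shi), some (_, thi) =>
    match lllLoN nlo with
    | none => none
    | some lll => some ⟨[11, 3, 2, 2], nlo, Nat.sub shi nlo, e0, lll, thi, none⟩
  | _, _, _ => none


/-! ## Soundness, part 1: the arithmetic primitives -/

section ArithSound
open Finset

/-- Primitive operations are the usual ones (for rewriting computable definitions). [folklore] -/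
theorem natdiv_eq (a b : ℕ) : Nat.div a b = a / b := rfl
/-- [folklore] -/
theorem natmod_eq (a b : ℕ) : Nat.mod a b = a % b := rfl
/-- [folklore] -/
theorem SC_eq : SC = 2 ^ 80 := by norm_num [SC]
/-- [folklore] -/
theorem SC_real : (SC : ℝ) = 2 ^ 80 := by norm_num [SC]

/-- Floor division bounds in `ℝ`: `⌊a/b⌋ ≤ a/b < ⌊a/b⌋ + 1`. [folklore] -/
theorem natDiv_real_bounds (a : ℕ) {b : ℕ} (hb : 0 < b) :
    ((a / b : ℕ) : ℝ) ≤ (a : ℝ) / b ∧ (a : ℝ) / b < ((a / b : ℕ) : ℝ) + 1 := by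
  refine ⟨Nat.cast_div_le, ?_⟩
  have h := Nat.lt_div_mul_add (a := a) hb
  have hbR : (0 : ℝ) < b := by exact_mod_cast hb
  rw [div_lt_iff₀ hbR]
  have : (a : ℝ) < ((a / b : ℕ) : ℝ) * b + b := by exact_mod_cast h
  linarith

/-! ### `gsum` -/

/-- `gsum c j = ∑_{i ≤ j} c^i`. [folklore] -/
theorem gsum_eq_sum (c : ℕ) : ∀ j : ℕ, gsum c j = ∑ i ∈ range (j + 1), c ^ i
  | 0 => by simp [gsum]
  | j + 1 => by
      rw [gsum, Nat.add_eq, Nat.mul_eq, gsum_eq_sum c j]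
      conv_rhs => rw [Finset.sum_range_succ']
      rw [Finset.mul_sum, pow_zero]
      congr 1
      exact Finset.sum_congr rfl fun i _ => by ring

/-- The recursion in `ℝ`: `gsum c (j+1) = c · gsum c j + 1`. [folklore] -/
theorem gsum_succ_real (c j : ℕ) : (gsum c (j + 1) : ℝ) = c * gsum c j + 1 := by
  rw [gsum, Nat.add_eq, Nat.mul_eq]; push_cast; ring

/-- At a prime, `gsum q j = σ(q^j)`. [folklore] -/
theorem gsum_eq_sigma {q : ℕ} (hq : q.Prime) (j : ℕ) :
    gsum q j = ArithmeticFunction.sigma 1 (q ^ j) := by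
  rw [gsum_eq_sum, ArithmeticFunction.sigma_one_apply_prime_pow hq]

/-- `1 ≤ gsum c j`. [folklore] -/
theorem one_le_gsum (c j : ℕ) : 1 ≤ gsum c j := by
  cases j <;> simp [gsum]

/-- `gsum c j = Envelope.geomSum c j` in `ℝ`. [folklore] -/
theorem gsum_eq_geomSum (c j : ℕ) : (gsum c j : ℝ) = Literature.NumberTheory.LFunctions.Envelope.geomSum (c : ℝ) j := by
  rw [gsum_eq_sum, Literature.NumberTheory.LFunctions.Envelope.geomSum]; push_cast; rfl

/-! ### The series `log(1 + y)` -/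

/-- The alternating partial sum `E_m(y) = ∑_{k<m} (−1)^k y^{k+1}/(k+1)`. [folklore] -/
noncomputable def altSum (y : ℝ) (m : ℕ) : ℝ := ∑ k ∈ range m, (-1 : ℝ) ^ k * y ^ (k + 1) / (k + 1)

/-- `E_m(y) = −∑_{k<m} (−y)^{k+1}/(k+1)` (the form of Mathlib's `abs_log_sub_add_sum_range_le`).
[folklore] -/
theorem altSum_eq_neg (y : ℝ) (m : ℕ) :
    altSum y m = -∑ i ∈ range m, (-y) ^ (i + 1) / (i + 1) := by
  unfold altSum
  rw [← Finset.sum_neg_distrib]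
  refine Finset.sum_congr rfl fun k _ => ?_
  have e : (-y) ^ (k + 1) = (-1) ^ (k + 1) * y ^ (k + 1) := neg_pow y (k + 1)
  rw [e, pow_succ]
  ring

/-- `|log(1+y) − E_m(y)| ≤ y^{m+1}/(1−y)` for `0 ≤ y < 1`. [folklore] -/
theorem abs_log_one_add_sub_altSum_le {y : ℝ} (hy0 : 0 ≤ y) (hy1 : y < 1) (m : ℕ) :
    |Real.log (1 + y) - altSum y m| ≤ y ^ (m + 1) / (1 - y) := by
  have hx : |(-y)| < 1 := by rw [abs_neg, abs_of_nonneg hy0]; exact hy1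
  have h := Real.abs_log_sub_add_sum_range_le hx m
  rw [abs_neg, abs_of_nonneg hy0, sub_neg_eq_add] at h
  rw [altSum_eq_neg]
  have e : Real.log (1 + y) - -∑ i ∈ range m, (-y) ^ (i + 1) / (i + 1) =
      ∑ i ∈ range m, (-y) ^ (i + 1) / (i + 1) + Real.log (1 + y) := by ring
  rw [e]; exact h

/-- `E_{j}(y) − E_{j−1}(y) = (−1)^{j−1} y^j/j` (`j ≥ 1`). [folklore] -/
theorem altSum_step (y : ℝ) {j : ℕ} (hj : 1 ≤ j) :
    altSum y j = altSum y (j - 1) + (-1 : ℝ) ^ (j - 1) * y ^ j / j := by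
  obtain ⟨k, rfl⟩ : ∃ k, j = k + 1 := ⟨j - 1, by omega⟩
  simp only [Nat.add_sub_cancel, altSum, Finset.sum_range_succ]
  push_cast
  ring_nf

/-- **Specification of the term loop.** With `y = p/q` (`0 < q`), entry data `P = p^j`, `Q = q^j`,
`1 ≤ j`, and result `(pos', neg', no', ne', tn)`: there is `m ≥ j − 1` (the index of the last term
used) with `no' + ne' = no + ne + (m + 1 − j)`,
`2⁸⁰ (E_m − E_{j−1}) − (no' − no) ≤ (pos' − pos) − (neg' − neg) ≤ 2⁸⁰ (E_m − E_{j−1}) + (ne' − ne)`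
and `2⁸⁰ y^{m+1}/(m+1) < tn + 1`. [folklore] -/
theorem lnpGo_spec (p : ℕ) {q : ℕ} (hq : 0 < q) :
    ∀ (fuel j pos neg no ne : ℕ), 1 ≤ j →
      ∃ m : ℕ, j ≤ m + 1 ∧
        (lnpGo p q fuel j (p ^ j) (q ^ j) pos neg no ne).2.2.1 +
            (lnpGo p q fuel j (p ^ j) (q ^ j) pos neg no ne).2.2.2.1 = no + ne + (m + 1 - j) ∧
        no ≤ (lnpGo p q fuel j (p ^ j) (q ^ j) pos neg no ne).2.2.1 ∧
        ne ≤ (lnpGo p q fuel j (p ^ j) (q ^ j) pos neg no ne).2.2.2.1 ∧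
        (2 : ℝ) ^ 80 * (altSum ((p : ℝ) / q) m - altSum ((p : ℝ) / q) (j - 1)) -
            (((lnpGo p q fuel j (p ^ j) (q ^ j) pos neg no ne).2.2.1 : ℝ) - no) ≤
          (((lnpGo p q fuel j (p ^ j) (q ^ j) pos neg no ne).1 : ℝ) - pos) -
            (((lnpGo p q fuel j (p ^ j) (q ^ j) pos neg no ne).2.1 : ℝ) - neg) ∧
        (((lnpGo p q fuel j (p ^ j) (q ^ j) pos neg no ne).1 : ℝ) - pos) -
            (((lnpGo p q fuel j (p ^ j) (q ^ j) pos neg no ne).2.1 : ℝ) - neg) ≤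
          (2 : ℝ) ^ 80 * (altSum ((p : ℝ) / q) m - altSum ((p : ℝ) / q) (j - 1)) +
            (((lnpGo p q fuel j (p ^ j) (q ^ j) pos neg no ne).2.2.2.1 : ℝ) - ne) ∧
        (2 : ℝ) ^ 80 * (((p : ℝ) / q) ^ (m + 1) / (m + 1)) <
          ((lnpGo p q fuel j (p ^ j) (q ^ j) pos neg no ne).2.2.2.2 : ℝ) + 1 := by
  intro fuel
  have hqR : (0 : ℝ) < q := by exact_mod_cast hq
  -- the term and its real value
  have hterm : ∀ j : ℕ, 1 ≤ j →
      ((SC * p ^ j / (j * q ^ j) : ℕ) : ℝ) ≤ 2 ^ 80 * (((p : ℝ) / q) ^ j / j) ∧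
      2 ^ 80 * (((p : ℝ) / q) ^ j / j) < ((SC * p ^ j / (j * q ^ j) : ℕ) : ℝ) + 1 := by
    intro j hj
    have hpos : 0 < j * q ^ j := Nat.mul_pos (by omega) (pow_pos hq j)
    obtain ⟨h1, h2⟩ := natDiv_real_bounds (SC * p ^ j) hpos
    have e : ((SC * p ^ j : ℕ) : ℝ) / ((j * q ^ j : ℕ) : ℝ) = 2 ^ 80 * (((p : ℝ) / q) ^ j / j) := by
      have hjR : (j : ℝ) ≠ 0 := by exact_mod_cast (show j ≠ 0 by omega)
      push_cast
      rw [SC_real, div_pow]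
      field_simp
    rw [e] at h1 h2
    exact ⟨h1, h2⟩
  induction fuel with
  | zero =>
    intro j pos neg no ne hj
    refine ⟨j - 1, by omega, ?_, le_rfl, le_rfl, ?_, ?_, ?_⟩
    · simp [lnpGo]; omega
    · simp [lnpGo]
    · simp [lnpGo]
    · simp only [lnpGo, natdiv_eq, Nat.mul_eq]
      rw [show j - 1 + 1 = j by omega]
      have hmj : ((j - 1 : ℕ) : ℝ) + 1 = (j : ℝ) := by exact_mod_cast Nat.sub_add_cancel hj
      rw [hmj]
      exact (hterm j hj).2
  | succ fuel ih =>
    intro j pos neg no ne hj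
    have ht := hterm j hj
    -- unfold one step of the loop
    have hunf : lnpGo p q (fuel + 1) j (p ^ j) (q ^ j) pos neg no ne =
        (bif Nat.beq (SC * p ^ j / (j * q ^ j)) 0 then (pos, neg, no, ne, 0)
        else bif Nat.beq (j % 2) 1 then
          lnpGo p q fuel (j + 1) (p ^ (j + 1)) (q ^ (j + 1)) (pos + SC * p ^ j / (j * q ^ j)) neg (no + 1) ne
        else lnpGo p q fuel (j + 1) (p ^ (j + 1)) (q ^ (j + 1)) pos (neg + SC * p ^ j / (j * q ^ j)) no
          (ne + 1)) := by
      simp only [lnpGo, natdiv_eq, natmod_eq, Nat.add_eq, Nat.mul_eq, pow_succ]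
    set t : ℕ := SC * p ^ j / (j * q ^ j) with htdef
    have hmj : ((j - 1 : ℕ) : ℝ) + 1 = (j : ℝ) := by exact_mod_cast Nat.sub_add_cancel hj
    have hstepE := altSum_step ((p : ℝ) / q) hj
    by_cases ht0 : t = 0
    · -- the term vanished
      rw [hunf, ht0]
      simp only [Nat.beq, cond_true]
      refine ⟨j - 1, by omega, by omega, le_rfl, le_rfl, ?_, ?_, ?_⟩
      · simp
      · simp
      · rw [show j - 1 + 1 = j by omega, hmj]
        have h2 := ht.2
        rw [ht0] at h2
        push_cast at h2 ⊢
        linarith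
    · have hbeq : Nat.beq t 0 = false := by
        cases h : Nat.beq t 0
        · rfl
        · exact absurd (Nat.eq_of_beq_eq_true h) ht0
      rw [hunf, hbeq]
      simp only [cond_false]
      rcases Nat.mod_two_eq_zero_or_one j with hpar | hpar
      · -- `j` even: the term goes to `neg`
        have hb : Nat.beq (j % 2) 1 = false := by rw [hpar]; rfl
        rw [hb]; simp only [cond_false]
        obtain ⟨m, hm1, hcnt, hno, hne, hlo, hhi, hrem⟩ := ih (j + 1) pos (neg + t) no (ne + 1) (by omega)
        rw [Nat.add_sub_cancel] at hlo hhi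
        have hsign : (-1 : ℝ) ^ (j - 1) = -1 := by
          have hodd : Odd (j - 1) := by
            rcases Nat.even_or_odd j with hev | hod
            · rcases hev with ⟨k, hk⟩
              exact ⟨k - 1, by omega⟩
            · exact absurd (Nat.odd_iff.1 hod) (by omega)
          exact hodd.neg_one_pow
        rw [hsign] at hstepE
        refine ⟨m, by omega, by omega, hno, by omega, ?_, ?_, hrem⟩
        · rw [hstepE] at hlo
          have k := ht.1
          push_cast at hlo ⊢
          ring_nf at hlo k ⊢
          linarith
        · rw [hstepE] at hhi
          have k := ht.2
          push_cast at hhi ⊢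
          ring_nf at hhi k ⊢
          linarith
      · -- `j` odd: the term goes to `pos`
        have hb : Nat.beq (j % 2) 1 = true := by rw [hpar]; rfl
        rw [hb]; simp only [cond_true]
        obtain ⟨m, hm1, hcnt, hno, hne, hlo, hhi, hrem⟩ := ih (j + 1) (pos + t) neg (no + 1) ne (by omega)
        rw [Nat.add_sub_cancel] at hlo hhi
        have hsign : (-1 : ℝ) ^ (j - 1) = 1 := by
          have hev : Even (j - 1) := by
            rcases Nat.even_or_odd j with hev | hod
            · exact absurd (Nat.even_iff.1 hev) (by omega)
            · rcases hod with ⟨k, hk⟩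
              exact ⟨k, by omega⟩
          exact hev.neg_one_pow
        rw [hsign] at hstepE
        refine ⟨m, by omega, by omega, by omega, hne, ?_, ?_, hrem⟩
        · rw [hstepE] at hlo
          have k := ht.2
          push_cast at hlo ⊢
          ring_nf at hlo k ⊢
          linarith
        · rw [hstepE] at hhi
          have k := ht.1
          push_cast at hhi ⊢
          ring_nf at hhi k ⊢
          linarith

/-- **Soundness of `lnp`**: for `0 < q` and `2p ≤ q`, `lo ≤ 2⁸⁰ log(1 + p/q) ≤ hi`. [folklore] -/
theorem lnp_sound {p q : ℕ} (hq : 0 < q) (hpq : 2 * p ≤ q) :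
    ((lnp p q).1 : ℝ) ≤ 2 ^ 80 * Real.log (1 + (p : ℝ) / q) ∧
      2 ^ 80 * Real.log (1 + (p : ℝ) / q) ≤ ((lnp p q).2 : ℝ) := by
  have hqR : (0 : ℝ) < q := by exact_mod_cast hq
  set y : ℝ := (p : ℝ) / q with hy
  have hy0 : 0 ≤ y := by positivity
  have hy2 : y ≤ 1 / 2 := by
    rw [hy, div_le_iff₀ hqR]
    have : (2 : ℝ) * p ≤ q := by exact_mod_cast hpq
    linarith
  have hy1 : y < 1 := by linarith
  have hlog0 : 0 ≤ Real.log (1 + y) := Real.log_nonneg (by linarith)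
  obtain ⟨m, -, hcnt, -, -, hlo, hhi, hrem⟩ := lnpGo_spec p hq 100 1 0 0 0 0 le_rfl
  rw [pow_one, pow_one] at hcnt hlo hhi hrem
  have hA0 : altSum ((p : ℝ) / q) 0 = 0 := by simp [altSum]
  simp only [Nat.sub_self, hA0, sub_zero, Nat.cast_zero, zero_add] at hcnt hlo hhi hrem
  -- name the result
  set r := lnpGo p q 100 1 p q 0 0 0 0 with hr
  obtain ⟨pos, neg, no, ne, tn⟩ := r
  simp only at hcnt hlo hhi hrem
  have hrem' := abs_log_one_add_sub_altSum_le hy0 hy1 m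
  have hR : (2 : ℝ) ^ 80 * (y ^ (m + 1) / (1 - y)) < 2 * ((no : ℝ) + ne + 1) * ((tn : ℝ) + 1) := by
    have h1 : y ^ (m + 1) / (1 - y) ≤ 2 * y ^ (m + 1) := by
      rw [div_le_iff₀ (by linarith)]
      nlinarith [pow_nonneg hy0 (m + 1)]
    have hm : ((no : ℝ) + ne) = m := by
      have : no + ne = m := by omega
      exact_mod_cast this
    have h2 : (2 : ℝ) ^ 80 * (2 * y ^ (m + 1)) = 2 * ((m : ℝ) + 1) * (2 ^ 80 * (y ^ (m + 1) / (m + 1))) := by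
      field_simp
    calc (2 : ℝ) ^ 80 * (y ^ (m + 1) / (1 - y)) ≤ 2 ^ 80 * (2 * y ^ (m + 1)) := by
          apply mul_le_mul_of_nonneg_left h1 (by positivity)
      _ = 2 * ((m : ℝ) + 1) * (2 ^ 80 * (y ^ (m + 1) / (m + 1))) := h2
      _ < 2 * ((m : ℝ) + 1) * ((tn : ℝ) + 1) := by
          apply mul_lt_mul_of_pos_left hrem (by positivity)
      _ = 2 * ((no : ℝ) + ne + 1) * ((tn : ℝ) + 1) := by rw [← hm]
  have habs := abs_le.1 hrem'
  -- the two bounds on `2⁸⁰ log(1+y)`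
  have h80 : (0 : ℝ) < 2 ^ 80 := by positivity
  have hm2 := mul_le_mul_of_nonneg_left habs.2 h80.le
  have hm1 := mul_le_mul_of_nonneg_left habs.1 h80.le
  have hup : 2 ^ 80 * Real.log (1 + y) < (pos : ℝ) - neg + no + 2 * ((no : ℝ) + ne + 1) * ((tn : ℝ) + 1) := by
    rw [mul_sub] at hm2
    linarith [hlo, hR]
  have hdown : (pos : ℝ) - neg - ne - 2 * ((no : ℝ) + ne + 1) * ((tn : ℝ) + 1) < 2 ^ 80 * Real.log (1 + y) := by
    rw [mul_sub, mul_neg] at hm1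
    linarith [hhi, hR]
  -- unfold `lnp`
  have hlnp : lnp p q = (pos - (neg + ne + 2 * (no + ne + 1) * (tn + 1)),
      pos + no + 2 * (no + ne + 1) * (tn + 1) - neg) := by
    unfold lnp
    rw [← hr]
    simp only [Nat.sub_eq, Nat.add_eq, Nat.mul_eq]
  rw [hlnp]
  constructor
  · -- lower bound: truncated subtraction is harmless
    simp only
    rcases le_or_gt (neg + ne + 2 * (no + ne + 1) * (tn + 1)) pos with hle | hlt
    · rw [Nat.cast_sub hle]; push_cast; linarith
    · rw [Nat.sub_eq_zero_of_le hlt.le]; push_cast; exact mul_nonneg (by positivity) hlog0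
  · simp only
    have hle : neg ≤ pos + no + 2 * (no + ne + 1) * (tn + 1) := by
      have : (neg : ℝ) < (pos : ℝ) + no + 2 * ((no : ℝ) + ne + 1) * ((tn : ℝ) + 1) := by linarith
      exact_mod_cast this.le
    rw [Nat.cast_sub hle]; push_cast; linarith

/-! ### `logN`, `mulLo`, the constants -/

/-- **Soundness of `logN`**: `lo ≤ 2⁸⁰ log n ≤ hi` and `0 < lo`. [folklore] -/
theorem logN_sound {n lo hi : ℕ} (h : logN n = some (lo, hi)) :
    (lo : ℝ) ≤ 2 ^ 80 * Real.log n ∧ 2 ^ 80 * Real.log n ≤ hi ∧ 0 < lo := by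
  unfold logN at h
  rcases hl : logIv n with _ | ⟨lo', hi'⟩
  · rw [hl] at h; simp at h
  · rw [hl] at h
    simp only at h
    split_ifs at h with hpos
    push Not at hpos
    simp only [Option.some.injEq, Prod.mk.injEq] at h
    obtain ⟨rfl, rfl⟩ := h
    obtain ⟨h1, h2⟩ := logIv_sound hl
    have h80 : (0 : ℝ) < 2 ^ 80 := by positivity
    rw [div_le_iff₀ h80] at h1
    rw [le_div_iff₀ h80] at h2
    have hlo' : ((lo'.toNat : ℕ) : ℝ) = (lo' : ℝ) := by exact_mod_cast Int.toNat_of_nonneg hpos.le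
    have hhi0 : (0 : ℝ) ≤ hi' := by
      have : (lo' : ℝ) ≤ hi' := by linarith
      have h0 : (0 : ℝ) < lo' := by exact_mod_cast hpos
      linarith
    have hhi0' : 0 ≤ hi' := by exact_mod_cast hhi0
    have hhi' : ((hi'.toNat : ℕ) : ℝ) = (hi' : ℝ) := by exact_mod_cast Int.toNat_of_nonneg hhi0'
    refine ⟨by rw [hlo']; linarith, by rw [hhi']; linarith, ?_⟩
    have : (0 : ℤ) < (lo'.toNat : ℤ) := by rw [Int.toNat_of_nonneg hpos.le]; exact hpos
    exact_mod_cast this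

/-- `mulLo e b ≤ e·b/2⁸⁰ < mulLo e b + 1`. [folklore] -/
theorem mulLo_bounds (e b : ℕ) :
    ((mulLo e b : ℕ) : ℝ) ≤ (e : ℝ) * b / 2 ^ 80 ∧ (e : ℝ) * b / 2 ^ 80 < ((mulLo e b : ℕ) : ℝ) + 1 := by
  unfold mulLo
  rw [natdiv_eq, Nat.mul_eq]
  have h := natDiv_real_bounds (e * b) (b := SC) (by norm_num [SC])
  rw [SC_real] at h
  push_cast at h
  exact h

/-- `L2LON ≤ 2⁸⁰ log 2`. [folklore] -/
theorem L2LON_le : (L2LON : ℝ) ≤ 2 ^ 80 * Real.log 2 := by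
  have h := Literature.Analysis.SpecialFunctions.Real.log_two_gt_d20
  have : (L2LON : ℝ) ≤ 2 ^ 80 * (0.69314718055994530940 : ℝ) := by norm_num [L2LON]
  nlinarith

/-- `2⁸⁰ log 2 ≤ L2HIN`. [folklore] -/
theorem le_L2HIN : 2 ^ 80 * Real.log 2 ≤ (L2HIN : ℝ) := by
  have h := Literature.Analysis.SpecialFunctions.Real.log_two_lt_d20
  have : 2 ^ 80 * (0.69314718055994530944 : ℝ) ≤ (L2HIN : ℝ) := by norm_num [L2HIN]
  nlinarith

/-- `GAMMALO ≤ 2⁸⁰ γ`. [folklore] -/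
theorem GAMMALO_le : (GAMMALO : ℝ) ≤ 2 ^ 80 * Real.eulerMascheroniConstant := by
  have h := Literature.Analysis.SpecialFunctions.Real.eulerMascheroniConstant_gt_d8
  have : (GAMMALO : ℝ) ≤ 2 ^ 80 * (0.57721558 : ℝ) := by norm_num [GAMMALO]
  nlinarith

end ArithSound

end Literature.NumberTheory.LFunctions.ChainCheck
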